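import Summits.CriticalPhenomena.PercolationContinuityZ3.Theses.PercNearOneGluing
import Literature.Probability.Percolation.PercolationProofs
import Literature.Probability.Percolation.ConditionalPositiveAssociationProofs
import Literature.Probability.Percolation.TwoClusterConditionalAssociationProofs
import Summits.CriticalPhenomena.PercolationContinuityZ3.Theorems.PercNearOneGluingAdditiveGluingGoodStepLevelSet

/-! TTRL-lite variant V1416 of stmt-CriticalPhenomena-4576 -/

namespace Summit.CriticalPhenomena.PercolationContinuityZ3.Theorems

open MeasureTheory Literature.Probability.LatticeModels Literature.Probability.Percolation
open scoped Classical BigOperators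

/-- TTRL-lite variant V1416 of `stub_goodStep` (stmt-CriticalPhenomena-4576): if the observer `o` is itself
`t`-reliable (`1 - t ≤ μ(o ↔ b)`) then the good functional is at most `μ(o ↮ b) = 1 - μ(o ↔ b) ≤ t`
(trivial bound `goodLevel_lhs_le`, valid because `b ∈ A`). [folklore] -/
theorem stub_goodStep_var1416 :
    ∀ (n : ℕ) (w : Sym2 (Fin n) → unitInterval) (A : Finset (Fin n)) (o b : Fin n) (t : ℝ)
      (sel : Finset (Fin n) → Fin n), b ∈ A → 1 - t ≤ (prodBernoulli w).real (openConn o b) →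
      (prodBernoulli w).real ((⋃ a ∈ A, openConn o a) ∩ (openConn o b)ᶜ) +
          ∑ W ∈ (Finset.univ : Finset (Finset (Fin n))).filter (fun W => o ∈ W ∧ Disjoint W A),
            (prodBernoulli w).real {ω : BondConfig (Fin n) | openCluster ω o = (W : Set (Fin n))} *
              (prodBernoulli w).real (openConnIn ((W : Set (Fin n))ᶜ) (sel W) b)ᶜ ≤ t := by
  intro n w A o b t sel hbA ht
  have h1 := goodLevel_lhs_le w A o b hbA sel
  have h2 : (prodBernoulli w).real (openConn o b : Set (BondConfig (Fin n)))ᶜ =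
      1 - (prodBernoulli w).real (openConn o b : Set (BondConfig (Fin n))) :=
    probReal_compl_eq_one_sub (Set.toFinite _).measurableSet
  linarith

end Summit.CriticalPhenomena.PercolationContinuityZ3.Theorems
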